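import Summits.CriticalPhenomena.PercolationContinuityZ3.Theorems.PercNearOneGluingNoHeavyLowerTailNCopyCertAlgebra
import Summits.CriticalPhenomena.PercolationContinuityZ3.Theorems.PercNearOneGluingNoHeavyLowerTailSahiC3CubeEvents
import Literature.Combinatorics.Sahi2008.Percolation

/-!
# `NoHeavyLowerTail` (stmt-CriticalPhenomena-4575) — Sahi's `E_n` on the cube `{0,1}^m`, EVERY order `n`, every product measure:
# the Lieb–Sahi recursion run symbolically, and a kernel-checkable `n`-copy certificate

Support file, seat `prim-l12-p5` (gen 5), `--supports stmt-CriticalPhenomena-4575`; continues `…NCopyCertAlgebra`.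

The tree DEFINES Sahi's functional by the Lieb–Sahi recursion [LiebSahi2021, Prop. 3.3] (`Literature.Combinatorics.Sahi2008.sahiE`,
`sahiE_succ_succ` is `rfl`): `E_1(f) = E(f)`, `E_{n+2}(f, g_0..g_n) = Σ_i E_{n+1}(g with g_i ↦ g_i·f) − E_{n+1}(g)·E(f)`.  For a product
measure `μ_p` on `2^{Fin m}` and indicator functions of events, `E` is the multilinear polynomial of the event's bitmask table
(`SahiC3Cube.real_eq_ML_cube`) and products of indicators are indicators of intersections (bitwise AND).  Running the SAME recursion on
degree-indexed coefficient vectors (`NCopyCert.convT`: multiplying by the table of `f`, or by the all-ones table to raise the degree) gives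

* `sahiCoef m n a` — for bitmasks `a : Fin n → ℕ`, the degree-`n` tensor-Bernstein coefficient vector of `p ↦ E_n(μ_p; events of a)`:
  **`evB_sahiCoef`**: `evB n (sahiCoef m n (encA ∘ A)) p = sahiE (bernoulliWeight p) n (ind ∘ A)` for every `p : Fin m → [0,1]` and every family of
  events `A : Fin n → Set (Set (Fin m))` (induction along the tree's definition; any `m`, any `n`);
* `sahiKr KT F n a` — the same recursion on Kronecker numbers (`KT` = Kronecker number of a bitmask table, base `2^σ`, positions in base `b`;
  `F` = number of the full cube), executable; **`krB_sahiCoef`**: it computes `krB b (2^σ) n (sahiCoef m n a)` whenever `KT` agrees with `krTB σ b m`;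
* `coefBound m n = n!·2^{mn}` bounds the coefficients (`abs_sahiCoef_le`);
* `checkFamW` — the digit test of one family; **`sahiE_ind_nonneg_of_checkFamW`**: if it passes (with `coefBound m n < 2^(σ−1)`), then
  `0 ≤ sahiE (bernoulliWeight p) n (ind ∘ A)` for EVERY `p` — Sahi's inequality of order `n` for that family under every product measure.

So the `n`-function positivity question on a cube is, family by family, a finite digit test — for every `n` (the tree had bespoke checkers for
`n = 3, 4` via the closed forms `sahiE_three/four`).  Used by `…SahiCubeFourResidualFive/Six` (`n = 5, 6` on `{0,1}^4`).  No sorries, no named facts.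
-/

namespace Summit.CriticalPhenomena.PercolationContinuityZ3.Theorems.NCopyCert

open Finset OneCutCert SahiC3Cube MeasureTheory
open scoped BigOperators
open Literature.Combinatorics.Sahi2008 (ex sahiE bernoulliWeight ex_bernoulliWeight_ind sahiE_succ_succ sahiE_zero sahiE_one_apply)
open Literature.Probability.Percolation (BHK2006.ind_inter)
open Literature.Probability.Percolation.DecisionTree (ind)
open Literature.Probability.LatticeModels (prodBernoulli)

variable {m : ℕ}

/-! ## Linearity of the two valuations -/

/-- `evB` of a pointwise difference. [this work] -/
theorem evB_sub (d : ℕ) (c₁ c₂ : (Fin m → Fin (d + 1)) → ℤ) (x : Fin m → ℝ) :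
    evB d (fun k => c₁ k - c₂ k) x = evB d c₁ x - evB d c₂ x := by
  unfold evB
  rw [← Finset.sum_sub_distrib]
  refine Finset.sum_congr rfl fun k _ => ?_
  push_cast
  ring

/-- `evB` of a pointwise finite sum. [this work] -/
theorem evB_finsum {ι : Type*} (s : Finset ι) (d : ℕ) (c : ι → (Fin m → Fin (d + 1)) → ℤ) (x : Fin m → ℝ) :
    evB d (fun k => ∑ i ∈ s, c i k) x = ∑ i ∈ s, evB d (c i) x := by
  unfold evB
  push_cast
  simp_rw [Finset.sum_mul]
  rw [Finset.sum_comm]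

/-- `krB` of a pointwise difference. [this work] -/
theorem krB_sub (b M d : ℕ) (c₁ c₂ : (Fin m → Fin (d + 1)) → ℤ) :
    krB b M d (fun k => c₁ k - c₂ k) = krB b M d c₁ - krB b M d c₂ := by
  unfold krB
  rw [← Finset.sum_sub_distrib]
  refine Finset.sum_congr rfl fun k _ => ?_
  ring

/-- `krB` of a pointwise finite sum. [this work] -/
theorem krB_finsum {ι : Type*} (s : Finset ι) (b M d : ℕ) (c : ι → (Fin m → Fin (d + 1)) → ℤ) :
    krB b M d (fun k => ∑ i ∈ s, c i k) = ∑ i ∈ s, krB b M d (c i) := by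
  unfold krB
  simp_rw [Finset.sum_mul]
  rw [Finset.sum_comm]

/-! ## The symbolic recursion -/

/-- **The Lieb–Sahi recursion on coefficient vectors.**  For bitmasks `a : Fin n → ℕ` of events of the `m`-cube, the degree-`n` coefficient
vector of `p ↦ E_n(μ_p; a)`: `C_1(t) = δ ⋆ T_t`, `C_{n+2}(f; g) = (Σ_i C_{n+1}(g, g_i ↦ g_i ∧ f)) ⋆ 1 − C_{n+1}(g) ⋆ T_f` (`C_0 := 0`). [this work] -/
def sahiCoef (m : ℕ) : (n : ℕ) → (Fin n → ℕ) → ((Fin m → Fin (n + 1)) → ℤ)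
  | 0, _ => fun _ => 0
  | 1, a => convT 0 delta0 (tabZ m (a 0))
  | n + 2, a => fun K =>
      (∑ i : Fin (n + 1), convT (n + 1) (sahiCoef m (n + 1) (Function.update (Fin.tail a) i (Fin.tail a i &&& a 0)))
          (tabZ m (fullN m)) K)
        - convT (n + 1) (sahiCoef m (n + 1) (Fin.tail a)) (tabZ m (a 0)) K

/-- **The same recursion on Kronecker numbers** (executable): `KT` supplies the Kronecker number of a bitmask table (in the soundness
theorem `KT = krTB σ b m`; callers may pass a table-backed version agreeing with it), `F` is the number of the full cube (padding a product to
one more factor). [this work] -/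
def sahiKr (KT : ℕ → ℤ) (F : ℤ) : (n : ℕ) → (Fin n → ℕ) → ℤ
  | 0, _ => 0
  | 1, a => KT (a 0)
  | n + 2, a =>
      F * (∑ i : Fin (n + 1), sahiKr KT F (n + 1) (Function.update (Fin.tail a) i (Fin.tail a i &&& a 0)))
        - sahiKr KT F (n + 1) (Fin.tail a) * KT (a 0)

/-- The a-priori coefficient bound `n!·2^{mn}` (recursively: `B_1 = 2^m`, `B_{n+2} = 2^m (n+2) B_{n+1}`). [this work] -/
def coefBound (m : ℕ) : ℕ → ℕ
  | 0 => 0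
  | 1 => 2 ^ m
  | n + 2 => 2 ^ m * ((n + 2) * coefBound m (n + 1))

/-- Unfolding `sahiCoef` at `n + 2`. [this work] -/
theorem sahiCoef_succ_succ (n : ℕ) (a : Fin (n + 2) → ℕ) :
    sahiCoef m (n + 2) a = fun K =>
      (∑ i : Fin (n + 1), convT (n + 1) (sahiCoef m (n + 1) (Function.update (Fin.tail a) i (Fin.tail a i &&& a 0)))
          (tabZ m (fullN m)) K)
        - convT (n + 1) (sahiCoef m (n + 1) (Fin.tail a)) (tabZ m (a 0)) K := rfl

/-- Unfolding `sahiKr` at `n + 2`. [this work] -/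
theorem sahiKr_succ_succ (KT : ℕ → ℤ) (F : ℤ) (n : ℕ) (a : Fin (n + 2) → ℕ) :
    sahiKr KT F (n + 2) a =
      F * (∑ i : Fin (n + 1), sahiKr KT F (n + 1) (Function.update (Fin.tail a) i (Fin.tail a i &&& a 0)))
        - sahiKr KT F (n + 1) (Fin.tail a) * KT (a 0) := rfl

/-! ## Bitmasks of intersections -/

/-- The bitmask of an intersection is the AND of the bitmasks. [this work] -/
theorem encA_inter (m : ℕ) (X Y : Set (Set (Fin m))) : encA m (X ∩ Y) = encA m X &&& encA m Y := by
  apply Nat.eq_of_testBit_eq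
  intro x
  rw [Nat.testBit_land, testBit_encA, testBit_encA, testBit_encA]
  by_cases hx : x < 2 ^ m
  · by_cases hX : pt m x ∈ X <;> by_cases hY : pt m x ∈ Y <;> simp [hx, hX, hY, Set.mem_inter_iff]
  · simp [hx]

/-! ## The recursion computes `E_n` -/

/-- **`evB n (sahiCoef (encA ∘ A)) p = E_n(μ_p; 1_{A_0}, …, 1_{A_{n−1}})`** for every product weight on `2^{Fin m}` and every family of events
(induction along the tree's recursive definition of `sahiE`). [this work] -/
theorem evB_sahiCoef (p : Fin m → unitInterval) : ∀ (n : ℕ) (A : Fin n → Set (Set (Fin m))),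
    evB n (sahiCoef m n (fun i => encA m (A i))) (fun i => (p i : ℝ)) = sahiE (bernoulliWeight p) n (fun i => ind (A i))
  | 0, A => by simp [evB, sahiCoef, sahiE_zero]
  | 1, A => by
    rw [sahiE_one_apply, ex_bernoulliWeight_ind, real_eq_ML_cube]
    show evB 1 (convT 0 delta0 (tabZ m (encA m (A 0)))) _ = _
    rw [evB_convT, evB_delta0, one_mul]
    rfl
  | n + 2, A => by
    set a : Fin (n + 2) → ℕ := fun i => encA m (A i) with ha
    have htail : Fin.tail a = fun j => encA m (Fin.tail A j) := rfl
    have hupd : ∀ i : Fin (n + 1), Function.update (Fin.tail a) i (Fin.tail a i &&& a 0)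
        = fun j => encA m (Function.update (Fin.tail A) i (Fin.tail A i ∩ A 0) j) := by
      intro i; funext j
      simp only [Function.update_apply, Fin.tail, ha]
      split_ifs with h
      · rw [encA_inter]
      · rfl
    have hupdF : ∀ i : Fin (n + 1), (fun j => ind (Function.update (Fin.tail A) i (Fin.tail A i ∩ A 0) j))
        = Function.update (Fin.tail (fun j => ind (A j))) i (Fin.tail (fun j => ind (A j)) i * ind (A 0)) := by
      intro i; funext j
      simp only [Function.update_apply, Fin.tail]
      split_ifs with h
      · funext ω; exact BHK2006.ind_inter _ _ ω
      · rfl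
    rw [sahiE_succ_succ, sahiCoef_succ_succ, evB_sub, evB_finsum]
    congr 1
    · refine Finset.sum_congr rfl fun i _ => ?_
      rw [evB_convT, hupd i, evB_sahiCoef p (n + 1), hupdF i]
      have h1 : ML (fun g => ((tabZ m (fullN m) g : ℤ) : ℝ)) (fun i => (p i : ℝ)) = 1 := ML_fullN m _
      rw [h1, mul_one]
    · rw [evB_convT, htail, evB_sahiCoef p (n + 1), ex_bernoulliWeight_ind, real_eq_ML_cube]
      rfl

/-- **`sahiKr` computes the Kronecker number of `sahiCoef`** (for any `KT` agreeing with `krTB σ b m`). [this work] -/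
theorem krB_sahiCoef (σ b : ℕ) {KT : ℕ → ℤ} (hKT : ∀ T, KT T = (krTB σ b m T : ℤ)) : ∀ (n : ℕ) (a : Fin n → ℕ),
    krB b (2 ^ σ) n (sahiCoef m n a) = sahiKr KT (krTB σ b m (fullN m)) n a
  | 0, a => by simp [krB, sahiCoef, sahiKr]
  | 1, a => by
    show krB b (2 ^ σ) 1 (convT 0 delta0 (tabZ m (a 0))) = KT (a 0)
    rw [krB_convT, krB_delta0, one_mul, hKT, krTB_eq]
  | n + 2, a => by
    rw [sahiCoef_succ_succ, sahiKr_succ_succ, krB_sub, krB_finsum, Finset.mul_sum]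
    congr 1
    · refine Finset.sum_congr rfl fun i _ => ?_
      rw [krB_convT, krB_sahiCoef σ b hKT (n + 1), krTB_eq]
      ring
    · rw [krB_convT, krB_sahiCoef σ b hKT (n + 1), hKT, krTB_eq σ b m (a 0)]

/-- **A-priori bound**: `|sahiCoef m n a K| ≤ coefBound m n`. [this work] -/
theorem abs_sahiCoef_le : ∀ (n : ℕ) (a : Fin n → ℕ) (K : Fin m → Fin (n + 1)), |sahiCoef m n a K| ≤ coefBound m n
  | 0, a, K => by simp [sahiCoef, coefBound]
  | 1, a, K => by
    show |convT 0 delta0 (tabZ m (a 0)) K| ≤ ((2 ^ m : ℕ) : ℤ)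
    have h := abs_convT_le (d := 0) (c := delta0) (B := 1) (fun k => by simp [delta0]) (abs_tabZ_le m (a 0)) K
    push_cast at h ⊢
    linarith
  | n + 2, a, K => by
    rw [sahiCoef_succ_succ]
    show |(∑ i : Fin (n + 1), _) - _| ≤ _
    have hB := abs_sahiCoef_le (n + 1)
    have h1 : ∀ i : Fin (n + 1), |convT (n + 1) (sahiCoef m (n + 1) (Function.update (Fin.tail a) i (Fin.tail a i &&& a 0)))
        (tabZ m (fullN m)) K| ≤ 2 ^ m * (coefBound m (n + 1) : ℤ) :=
      fun i => abs_convT_le (hB _) (abs_tabZ_le m _) K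
    have h2 : |convT (n + 1) (sahiCoef m (n + 1) (Fin.tail a)) (tabZ m (a 0)) K| ≤ 2 ^ m * (coefBound m (n + 1) : ℤ) :=
      abs_convT_le (hB _) (abs_tabZ_le m _) K
    have hsum := (Finset.abs_sum_le_sum_abs _ _).trans (Finset.sum_le_sum fun i (_ : i ∈ Finset.univ) => h1 i)
    rw [Finset.sum_const, Finset.card_univ, Fintype.card_fin, nsmul_eq_mul] at hsum
    calc |(∑ i : Fin (n + 1), convT (n + 1) (sahiCoef m (n + 1) (Function.update (Fin.tail a) i (Fin.tail a i &&& a 0)))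
            (tabZ m (fullN m)) K) - convT (n + 1) (sahiCoef m (n + 1) (Fin.tail a)) (tabZ m (a 0)) K|
        ≤ |∑ i : Fin (n + 1), convT (n + 1) (sahiCoef m (n + 1) (Function.update (Fin.tail a) i (Fin.tail a i &&& a 0)))
            (tabZ m (fullN m)) K| + |convT (n + 1) (sahiCoef m (n + 1) (Fin.tail a)) (tabZ m (a 0)) K| := abs_sub _ _
      _ ≤ (n + 1 : ℕ) * (2 ^ m * (coefBound m (n + 1) : ℤ)) + 2 ^ m * (coefBound m (n + 1) : ℤ) := add_le_add hsum h2
      _ = ((2 ^ m * ((n + 2) * coefBound m (n + 1)) : ℕ) : ℤ) := by push_cast; ring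

/-! ## The digit test of one family and its soundness -/

/-- The digit test of ONE family of bitmasks with precomputed full-cube number `F`, offset `off` and its `toNat` (the `n`-copy analogue of
`SahiC4Cube.checkQuadW`). [this work] -/
def checkFamW (KT : ℕ → ℤ) (F off : ℤ) (offN : ℕ) (n : ℕ) (a : Fin n → ℕ) : Bool :=
  let Z := sahiKr KT F n a + off
  decide (0 ≤ Z) && decide ((Z.toNat &&& offN) = offN)

/-- **Soundness of the digit test, every order**: if `coefBound m n < 2^(σ−1)` and the digit test of the bitmasks of `A` passes (base `2^σ`,
positions in base `n+1`, offset `maskN σ ((n+1)^m)`), then `E_n(μ_p; 1_{A_0},…,1_{A_{n−1}}) ≥ 0` for EVERY product weight `μ_p` on `2^{Fin m}`.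
[this work] -/
theorem sahiE_ind_nonneg_of_checkFamW {σ n : ℕ} (hσ : 0 < σ) (hbnd : coefBound m n < 2 ^ (σ - 1))
    {KT : ℕ → ℤ} (hKT : ∀ T, KT T = (krTB σ (n + 1) m T : ℤ))
    (p : Fin m → unitInterval) (A : Fin n → Set (Set (Fin m)))
    (h : checkFamW KT (krTB σ (n + 1) m (fullN m)) (maskN σ ((n + 1) ^ m)) (maskN σ ((n + 1) ^ m)) n
      (fun i => encA m (A i)) = true) :
    0 ≤ sahiE (bernoulliWeight p) n (fun i => ind (A i)) := by
  rw [← evB_sahiCoef]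
  have hx : InCube (fun i => (p i : ℝ)) := fun i => ⟨(p i).2.1, (p i).2.2⟩
  refine evB_nonneg ?_ hx
  unfold checkFamW at h
  simp only [Bool.and_eq_true, decide_eq_true_eq] at h
  obtain ⟨hZ, hland⟩ := h
  set c := sahiCoef m n (fun i => encA m (A i)) with hc
  have hB : ∀ k, |c k| < 2 ^ (σ - 1) := fun k =>
    lt_of_le_of_lt (abs_sahiCoef_le n _ k) (by exact_mod_cast hbnd)
  set N : ℕ := (sahiKr KT (krTB σ (n + 1) m (fullN m)) n (fun i => encA m (A i)) + (maskN σ ((n + 1) ^ m) : ℤ)).toNat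
    with hN
  have hNZ : (N : ℤ) = krB (n + 1) (2 ^ σ) n c + ∑ j : Fin ((n + 1) ^ m), (2 : ℤ) ^ (σ - 1) * (2 ^ σ) ^ (j : ℕ) := by
    rw [hN, Int.toNat_of_nonneg hZ, hc, krB_sahiCoef σ (n + 1) hKT, maskN_eq_sum σ hσ,
      Fin.sum_univ_eq_sum_range (fun j => (2 : ℤ) ^ (σ - 1) * (2 ^ σ) ^ j) ((n + 1) ^ m)]
  have hdig : ∀ j : ℕ, j < (n + 1) ^ m → 2 ^ (σ - 1) ≤ digit (2 ^ σ) N j :=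
    digit_ge_of_land σ hσ ((n + 1) ^ m) N hland
  exact coef_nonneg_of_digit_ge hσ hB N hNZ hdig

end Summit.CriticalPhenomena.PercolationContinuityZ3.Theorems.NCopyCert
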